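import Mathlib.LinearAlgebra.Matrix.Determinant.Basic
import Mathlib.LinearAlgebra.Matrix.Block
import Mathlib.Probability.Distributions.Poisson.PoissonLimitThm
import Literature.Analysis.TotalPositivity.PolyaFrequency
import Literature.Analysis.TotalPositivity.PolyaFrequencyClosure
import Literature.Analysis.TotalPositivity.MultiplyPositive
import Literature.Analysis.TotalPositivity.MultiplyPositiveProofs
import Literature.Analysis.TotalPositivity.PolyaFrequencyDeflation
import HarnessLib

/-!
# Pólya frequency sequences: products, the reciprocal `1/f(-z)`, geometric and exponential
# sequences — proved

Trunk T-ANALYSIS (Literature/Analysis/TotalPositivity). Part 1 of the decomposition of the named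
fact `Literature.Analysis.TotalPositivity.aswe_edrei` (PolyaFrequency.lean; Aissen–Edrei–Schoenberg–Whitney 1951,
Thm. 4 = Karlin 1968, Ch. 8, Thm. 5.3): the algebraic closure properties behind the EASY half
[AissenEdreiSchoenbergWhitney1951, Thm. 1, and the "obvious remarks" preceding it, p. 304: "The
class of generating functions of totally positive sequences is closed with respect to
multiplication … also obviously closed with respect to passage to the limit. These remarks,
together with the observation that the three functions `1 + αz`, `1/(1 - βz)`, `e^{γz}`
(`α ≥ 0, β ≥ 0, γ ≥ 0`) generate totally positive sequences, lead to" Thm. 1]; the same material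
is [KungRotaYan2009, Lemma 6.9.2 and Prop. 6.9.4].

* `IsPolyaFrequencySeq.conv` — PF is closed under the Cauchy product of sequences (product of
  generating functions): every `PF_m` is (`IsMultiplyPositiveSeq.conv`, Cauchy–Binet,
  `MultiplyPositiveProofs.lean`) and `PF = ∩ₘ PF_m`.
* `IsPolyaFrequencySeq.negRecipSeq` — **the reciprocal rule**: if `a` is PF with `a₀ = 1` then
  `negRecipSeq a`, the Taylor sequence of `1/f(-z)` (`f = Σ aₙ zⁿ`), is PF
  [KungRotaYan2009, Lemma 6.9.2; AissenSchoenbergWhitney1952, §2]. ALL minors are treated (the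
  tree's `toeplitzMinor_negRecipSeq_consecutive`, PolyaFrequencyDeflation.lean, covers consecutive
  columns): for the inverse pair `T_N(a) · T_N(recipSeq a) = 1` of truncated Toeplitz matrices,
  Jacobi's identity in block form (`det_mul_det_toBlocks₁₁`) is applied after TWO shuffles — rows
  `r ⊕ rᶜ` and columns `c ⊕ cᶜ` — whose permutation signs `(-1)^{Σ(rᵢ-i)}`, `(-1)^{Σ(cᵢ-i)}`
  (`det_one_submatrix_shuffle`, from `det_indMat_shuffle`) cancel against the checkerboard sign
  `(-1)^{Σrᵢ + Σcᵢ}` of `negRecipSeq`; what is left is a complementary minor of `(a_{i-j})`, `≥ 0`.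
* `isPolyaFrequencySeq_geometric` — `(βⁿ)ₙ`, the Taylor sequence of `1/(1 - βz)`, is PF for
  `β ≥ 0`: it is `negRecipSeq (1, β, 0, 0, …)` (`recipSeq_oneLinear`; `(1, β, 0, …)` is written
  `mulLinear δ β` with `δ` the unit sequence, as in `PolyaFrequencyClosure.lean`).
* `isPolyaFrequencySeq_exp` — `(γⁿ/n!)ₙ`, the Taylor sequence of `e^{γz}`, is PF for `γ ≥ 0`:
  the termwise limit of the coefficient sequences `(N choose n)(γ/N)ⁿ` of `(1 + γz/N)^N`
  [KungRotaYan2009, Prop. 6.9.4 (d)], using Mathlib's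
  `ProbabilityTheory.tendsto_choose_mul_pow_atTop`.

## References

* M. Aissen, A. Edrei, I. J. Schoenberg, A. Whitney, *On the generating functions of totally
  positive sequences*, Proc. Nat. Acad. Sci. USA 37 (1951) 303–307, p. 304 and Thm. 1.
  [AissenEdreiSchoenbergWhitney1951]
* M. Aissen, I. J. Schoenberg, A. M. Whitney, *On the generating functions of totally positive
  sequences I*, J. Analyse Math. 2 (1952) 93–103, §2. [AissenSchoenbergWhitney1952]
* J. P. S. Kung, G.-C. Rota, C. H. Yan, *Combinatorics: The Rota Way*, CUP 2009, §6.9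
  (Lemma 6.9.2, Lemma 6.9.3, Prop. 6.9.4). [KungRotaYan2009]
* S. Karlin, *Total Positivity I*, Stanford UP 1968, Ch. 8, §§1–3. [Karlin1968]
-/

noncomputable section

open Finset Matrix Filter Polynomial
open scoped Topology Nat

namespace Literature.Analysis.TotalPositivity

/-! ### Products of generating functions -/

/-- **PF is closed under convolution** (product of generating functions): "to the multiplication
of generating functions corresponds the multiplication of the corresponding matrices (1) while
the product of two totally positive matrices is clearly totally positive" (Cauchy–Binet, via
`IsMultiplyPositiveSeq.conv` for every order `m`).
[cite: AissenEdreiSchoenbergWhitney1951, p. 304] -/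
theorem IsPolyaFrequencySeq.conv {a b : ℕ → ℝ} (ha : IsPolyaFrequencySeq a)
    (hb : IsPolyaFrequencySeq b) : IsPolyaFrequencySeq (conv a b) :=
  isPolyaFrequencySeq_iff_forall.2 fun m =>
    (ha.isMultiplyPositiveSeq m).conv (hb.isMultiplyPositiveSeq m)

/-! ### Shuffle permutations and their signs -/

/-- **The shuffle equivalence of a strictly increasing selection.** A strictly increasing
`R : Fin p → Fin (p + q)` extends to an equivalence `Fin p ⊕ Fin q ≃ Fin (p + q)` which is `R` on
the left summand and the increasing enumeration of the complement of the range of `R` on the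
right summand. [folklore] -/
theorem exists_shuffle_equiv {p q : ℕ} (R : Fin p → Fin (p + q)) (hR : StrictMono R) :
    ∃ e : Fin p ⊕ Fin q ≃ Fin (p + q), (∀ i, e (Sum.inl i) = R i) ∧
      StrictMono (fun k : Fin q => e (Sum.inr k)) := by
  classical
  set s : Finset (Fin (p + q)) := (Finset.univ.image R)ᶜ with hs
  have hcard : s.card = q := by
    rw [hs, Finset.card_compl, Finset.card_image_of_injective _ hR.injective]
    simp
  set rc : Fin q ↪o Fin (p + q) := s.orderEmbOfFin hcard with hrcdef
  have hrc_ne : ∀ l i, rc l ≠ R i := by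
    intro l i h
    have hmem : rc l ∈ s := s.orderEmbOfFin_mem hcard l
    rw [hs, Finset.mem_compl] at hmem
    exact hmem (Finset.mem_image.2 ⟨i, Finset.mem_univ _, h.symm⟩)
  set e : Fin p ⊕ Fin q → Fin (p + q) := Sum.elim R rc with he
  have hinj : Function.Injective e := by
    rintro (i | l) (i' | l') h
    · simp only [he, Sum.elim_inl] at h; rw [hR.injective h]
    · simp only [he, Sum.elim_inl, Sum.elim_inr] at h; exact absurd h.symm (hrc_ne l' i)
    · simp only [he, Sum.elim_inl, Sum.elim_inr] at h; exact absurd h (hrc_ne l i')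
    · simp only [he, Sum.elim_inr] at h; rw [rc.injective h]
  have hbij : Function.Bijective e :=
    (Fintype.bijective_iff_injective_and_card e).2 ⟨hinj, by simp⟩
  exact ⟨Equiv.ofBijective e hbij, fun i => rfl, fun k l hkl => rc.strictMono hkl⟩

/-- **Sign of a shuffle.** For an equivalence `e : Fin p ⊕ Fin q ≃ Fin (p + q)` increasing on
each summand, the permutation matrix `(δ_{x, e y})` (columns listed in the order
`inl 0, …, inl (p-1), inr 0, …`) has determinant `(-1)^{Σᵢ (e (inl i) - i)}`
(from `det_indMat_shuffle`). [folklore] -/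
theorem det_one_submatrix_shuffle {p q : ℕ} (e : Fin p ⊕ Fin q ≃ Fin (p + q))
    (h1 : StrictMono fun i : Fin p => e (Sum.inl i))
    (h2 : StrictMono fun k : Fin q => e (Sum.inr k)) :
    ((1 : Matrix (Fin (p + q)) (Fin (p + q)) ℝ).submatrix finSumFinEquiv e).det =
      (-1) ^ ∑ i : Fin p, ((e (Sum.inl i) : ℕ) - i) := by
  classical
  set f : Fin (p + q) → Fin (p + q) := e ∘ finSumFinEquiv.symm with hf
  have hmat : ((1 : Matrix (Fin (p + q)) (Fin (p + q)) ℝ).submatrix finSumFinEquiv e).det =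
      (indMat (p + q) f).det := by
    rw [← Matrix.det_submatrix_equiv_self finSumFinEquiv.symm]
    congr 1
    ext x y
    simp [indMat, hf, Matrix.one_apply]
  rw [hmat]
  have hf_lo : ∀ i : Fin p, f (Fin.castAdd q i) = e (Sum.inl i) := by
    intro i
    simp [hf, finSumFinEquiv_symm_apply_castAdd]
  have hf_hi : ∀ k : Fin q, f (Fin.natAdd p k) = e (Sum.inr k) := by
    intro k
    simp [hf, finSumFinEquiv_symm_apply_natAdd]
  have hcast_lo : ∀ y : Fin (p + q), (y : ℕ) < p → ∃ i : Fin p, Fin.castAdd q i = y :=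
    fun y hy => ⟨⟨y, hy⟩, Fin.ext rfl⟩
  have hcast_hi : ∀ y : Fin (p + q), p ≤ (y : ℕ) → ∃ k : Fin q, Fin.natAdd p k = y :=
    fun y hy => ⟨⟨(y : ℕ) - p, by have := y.2; omega⟩, Fin.ext (by simp; omega)⟩
  have hfinj : Function.Injective f := e.injective.comp finSumFinEquiv.symm.injective
  have hf1 : ∀ y y' : Fin (p + q), (y' : ℕ) < p → y < y' → f y < f y' := by
    intro y y' hy' hyy'
    obtain ⟨i, rfl⟩ := hcast_lo y (lt_trans hyy' hy')
    obtain ⟨i', rfl⟩ := hcast_lo y' hy'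
    rw [hf_lo, hf_lo]
    exact h1 ((Fin.strictMono_castAdd q).lt_iff_lt.1 hyy')
  have hf2 : ∀ y y' : Fin (p + q), p ≤ (y : ℕ) → y < y' → f y < f y' := by
    intro y y' hy hyy'
    obtain ⟨k, rfl⟩ := hcast_hi y hy
    obtain ⟨k', rfl⟩ := hcast_hi y' (le_trans hy (le_of_lt hyy'))
    rw [hf_hi, hf_hi]
    exact h2 ((Fin.strictMono_natAdd p).lt_iff_lt.1 hyy')
  rw [det_indMat_shuffle (p + q) p f hfinj hf1 hf2]
  congr 1
  rw [Fin.sum_univ_add]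
  have h2' : (∑ k : Fin q, if ((Fin.natAdd p k : Fin (p + q)) : ℕ) < p then
      ((f (Fin.natAdd p k) : ℕ) - (Fin.natAdd p k : ℕ)) else 0) = 0 :=
    Finset.sum_eq_zero fun k _ => by simp
  rw [h2', add_zero]
  refine Finset.sum_congr rfl fun i _ => ?_
  have hi : ((Fin.castAdd q i : Fin (p + q)) : ℕ) < p := by simp
  rw [if_pos hi, hf_lo i]
  simp

/-- The transposed shuffle matrix `(δ_{e x, y})` has the same determinant. [folklore] -/
theorem det_one_submatrix_shuffle' {p q : ℕ} (e : Fin p ⊕ Fin q ≃ Fin (p + q))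
    (h1 : StrictMono fun i : Fin p => e (Sum.inl i))
    (h2 : StrictMono fun k : Fin q => e (Sum.inr k)) :
    ((1 : Matrix (Fin (p + q)) (Fin (p + q)) ℝ).submatrix e finSumFinEquiv).det =
      (-1) ^ ∑ i : Fin p, ((e (Sum.inl i) : ℕ) - i) := by
  rw [← det_one_submatrix_shuffle e h1 h2, ← Matrix.det_transpose]
  congr 1
  ext x y
  simp only [Matrix.transpose_apply, Matrix.submatrix_apply, Matrix.one_apply]
  by_cases h : e y = finSumFinEquiv x
  · rw [if_pos h, if_pos h.symm]
  · rw [if_neg h, if_neg (Ne.symm h)]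

/-! ### The reciprocal rule: `1/f(-z)` generates a PF sequence -/

/-- **All minors of the reciprocal sequence are non-negative.** For a PF sequence `a` with
`a₀ = 1` and `b = negRecipSeq a` (Taylor coefficients of `1/f(-z)`, `f = Σ aₙ zⁿ`), every minor of
`(b_{i-j})` with rows `r` and columns `c` (both strictly increasing) is `≥ 0`: it equals the
complementary minor of the truncated Toeplitz matrix of `a` (rows `cᶜ`, columns `rᶜ`) — Jacobi's
identity for the inverse pair `T_N(a) T_N(recipSeq a) = 1` after the row shuffle `r ⊕ rᶜ` and the
column shuffle `c ⊕ cᶜ`, the two shuffle signs cancelling the checkerboard sign of `negRecipSeq`.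
[KungRotaYan2009, Lemma 6.9.2 (proof via Thm. 6.6.9); Aissen–Schoenberg–Whitney 1952, §2]
[cite: KungRotaYan2009, Lemma 6.9.2] -/
theorem IsPolyaFrequencySeq.toeplitzMinor_negRecipSeq_nonneg {a : ℕ → ℝ}
    (hpf : IsPolyaFrequencySeq a) (h0 : a 0 = 1) {p : ℕ} (r c : Fin p → ℕ) (hr : StrictMono r)
    (hc : StrictMono c) : 0 ≤ toeplitzMinor (negRecipSeq a) r c := by
  classical
  -- ambient size `N = p + q`
  set q : ℕ := Finset.univ.sup r + Finset.univ.sup c + 1 with hq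
  have hrN : ∀ i, r i < p + q := fun i => by
    have : r i ≤ Finset.univ.sup r := Finset.le_sup (Finset.mem_univ i)
    omega
  have hcN : ∀ i, c i < p + q := fun i => by
    have : c i ≤ Finset.univ.sup c := Finset.le_sup (Finset.mem_univ i)
    omega
  set R : Fin p → Fin (p + q) := fun i => ⟨r i, hrN i⟩ with hRdef
  set Cc : Fin p → Fin (p + q) := fun i => ⟨c i, hcN i⟩ with hCdef
  have hR : StrictMono R := fun i j hij => show r i < r j from hr hij
  have hC : StrictMono Cc := fun i j hij => show c i < c j from hc hij
  obtain ⟨eR, heR, hrc⟩ := exists_shuffle_equiv R hR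
  obtain ⟨eC, heC, hcc⟩ := exists_shuffle_equiv Cc hC
  have hR' : StrictMono fun i : Fin p => eR (Sum.inl i) := by
    intro i j hij; simp only [heR]; exact hR hij
  have hC' : StrictMono fun i : Fin p => eC (Sum.inl i) := by
    intro i j hij; simp only [heC]; exact hC hij
  -- the inverse pair of truncated Toeplitz matrices
  set ψ : PowerSeries ℝ := PowerSeries.mk a with hψ
  have hψ0 : PowerSeries.constantCoeff ψ ≠ 0 := by simp [hψ, h0]
  set A := psToeplitz ψ (p + q) with hA
  set B := psToeplitz ψ⁻¹ (p + q) with hB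
  have hAB : A * B = 1 := by
    rw [hA, hB, ← psToeplitz_mul, PowerSeries.mul_inv_cancel _ hψ0, psToeplitz_one]
  have hdetA : A.det = 1 := by
    rw [hA, det_psToeplitz]; simp [hψ, h0]
  have hA'B' : A.submatrix eC eR * B.submatrix eR eC = 1 := by
    rw [Matrix.submatrix_mul_equiv, hAB, Matrix.submatrix_one_equiv]
  -- Jacobi in block form
  have hJ := det_mul_det_toBlocks₁₁ (A.submatrix eC eR) (B.submatrix eR eC) hA'B'
  -- the sign of the doubly shuffled matrix `A'`
  set σ : ℝ := (-1) ^ ((∑ i : Fin p, (c i - i)) + ∑ i : Fin p, (r i - i)) with hσ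
  have hσσ : σ * σ = 1 := by
    rw [hσ, ← pow_add, ← two_mul, pow_mul]
    norm_num
  have hdetA' : (A.submatrix eC eR).det = σ := by
    have h1 : A.submatrix ⇑eC ⇑eR = (1 : Matrix _ _ ℝ).submatrix eC finSumFinEquiv *
        (A.submatrix finSumFinEquiv finSumFinEquiv *
          (1 : Matrix _ _ ℝ).submatrix finSumFinEquiv eR) := by
      rw [Matrix.submatrix_mul_equiv, Matrix.mul_one, Matrix.submatrix_mul_equiv, Matrix.one_mul]
    rw [h1, Matrix.det_mul, Matrix.det_mul, Matrix.det_submatrix_equiv_self, hdetA, one_mul,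
      det_one_submatrix_shuffle' eC hC' hcc, det_one_submatrix_shuffle eR hR' hrc, hσ, pow_add]
    simp [heR, heC, hRdef, hCdef]
  -- the `₁₁` block of `B'` is the matrix of `recipSeq a` at `(rᵢ - cⱼ)`
  set M : Matrix (Fin p) (Fin p) ℝ := Matrix.of fun i j => seqZ (recipSeq a) ((r i : ℤ) - c j)
    with hM
  have hB11 : (B.submatrix eR eC).toBlocks₁₁ = M := by
    ext i j
    simp only [Matrix.toBlocks₁₁, Matrix.of_apply, Matrix.submatrix_apply, heR, heC, hM]
    rw [seqZ_natCast_sub_natCast, hB]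
    simp only [psToeplitz, Matrix.of_apply, hRdef, hCdef, recipSeq, hψ]
  -- the `₂₂` block of `A'` is a Toeplitz minor of `a` (rows `cᶜ`, columns `rᶜ`)
  have hA22 : (A.submatrix eC eR).toBlocks₂₂.det =
      toeplitzMinor a (fun k : Fin q => (eC (Sum.inr k) : ℕ)) (fun l => (eR (Sum.inr l) : ℕ)) := by
    unfold toeplitzMinor
    congr 1
    ext k l
    simp only [Matrix.toBlocks₂₂, Matrix.of_apply, Matrix.submatrix_apply]
    rw [hA, hψ, psToeplitz_mk_apply]
  have hA22_nonneg : 0 ≤ (A.submatrix eC eR).toBlocks₂₂.det := by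
    rw [hA22]
    exact hpf q _ _ (fun k l hkl => hcc hkl) (fun k l hkl => hrc hkl)
  -- `det M = σ · det A'₂₂`
  have hdetM : M.det = σ * (A.submatrix eC eR).toBlocks₂₂.det := by
    rw [← hJ, hB11, hdetA', ← mul_assoc, hσσ, one_mul]
  -- the target minor is `M` with row `i` scaled by `(-1)^{rᵢ}` and column `j` by `(-1)^{cⱼ}`
  have htarget : toeplitzMinor (negRecipSeq a) r c =
      (∏ i : Fin p, (-1 : ℝ) ^ (r i)) * ((∏ j : Fin p, (-1 : ℝ) ^ (c j)) * M.det) := by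
    unfold toeplitzMinor
    rw [← Matrix.det_mul_row, ← Matrix.det_mul_column]
    congr 1
    ext i j
    simp only [Matrix.of_apply, hM]
    rw [seqZ_natCast_sub_natCast, seqZ_natCast_sub_natCast]
    split_ifs with hji
    · rw [negRecipSeq, neg_one_pow_sub' hji]; ring
    · simp
  rw [htarget, hdetM, Finset.prod_pow_eq_pow_sum, Finset.prod_pow_eq_pow_sum, hσ, ← mul_assoc,
    ← mul_assoc, ← pow_add, ← pow_add]
  have hsr : ∑ i : Fin p, r i = (∑ i : Fin p, (r i - i)) + ∑ i : Fin p, (i : ℕ) := by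
    rw [← Finset.sum_add_distrib]
    exact Finset.sum_congr rfl fun i _ => (Nat.sub_add_cancel (le_of_strictMono_fin hr i)).symm
  have hsc : ∑ i : Fin p, c i = (∑ i : Fin p, (c i - i)) + ∑ i : Fin p, (i : ℕ) := by
    rw [← Finset.sum_add_distrib]
    exact Finset.sum_congr rfl fun i _ => (Nat.sub_add_cancel (le_of_strictMono_fin hc i)).symm
  have heven : Even ((∑ i : Fin p, r i) + (∑ i : Fin p, c i) +
      ((∑ i : Fin p, (c i - i)) + ∑ i : Fin p, (r i - i))) := by
    refine ⟨(∑ i : Fin p, (c i - i)) + (∑ i : Fin p, (r i - i)) + ∑ i : Fin p, (i : ℕ), ?_⟩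
    rw [hsr, hsc]; ring
  rw [heven.neg_one_pow, one_mul]
  exact hA22_nonneg

/-- **The reciprocal rule** (Aissen–Schoenberg–Whitney): if `a` is a Pólya frequency sequence
with `a₀ = 1`, then so is `negRecipSeq a`, the Taylor sequence of `1/f(-z)` where
`f(z) = Σ aₙ zⁿ` ("the power series … `1/f(a; -z)` [is the] generating function of a Pólya
frequency sequence"). [KungRotaYan2009, Lemma 6.9.2; Aissen–Schoenberg–Whitney 1952, §2]
[cite: KungRotaYan2009, Lemma 6.9.2] -/
theorem IsPolyaFrequencySeq.negRecipSeq {a : ℕ → ℝ} (hpf : IsPolyaFrequencySeq a)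
    (h0 : a 0 = 1) : IsPolyaFrequencySeq (negRecipSeq a) :=
  fun _ r c hr hc => hpf.toeplitzMinor_negRecipSeq_nonneg h0 r c hr hc

/-! ### The geometric sequence `(βⁿ)`: Taylor coefficients of `1/(1 - βz)` -/

/-- The two-term sequence `(1, β, 0, 0, …)` (generating function `1 + βz`) is `mulLinear` of the
unit sequence; its value at `0`. [folklore] -/
theorem oneLinear_zero (β : ℝ) : mulLinear (fun k => if k = 0 then (1 : ℝ) else 0) β 0 = 1 := by
  simp

/-- Value of `(1, β, 0, …)` at `1`. [folklore] -/
theorem oneLinear_one (β : ℝ) : mulLinear (fun k => if k = 0 then (1 : ℝ) else 0) β 1 = β := by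
  simp

/-- Values of `(1, β, 0, …)` beyond `1`. [folklore] -/
theorem oneLinear_add_two (β : ℝ) (k : ℕ) :
    mulLinear (fun k => if k = 0 then (1 : ℝ) else 0) β (k + 2) = 0 := by
  simp

/-- `(1, β, 0, …)` is PF for `β ≥ 0` (`1 + βz`). [AissenEdreiSchoenbergWhitney1951, p. 304;
KungRotaYan2009, Prop. 6.9.4 (a)] [cite: KungRotaYan2009, Prop. 6.9.4 (a)] -/
theorem isPolyaFrequencySeq_oneLinear {β : ℝ} (hβ : 0 ≤ β) :
    IsPolyaFrequencySeq (mulLinear (fun k => if k = 0 then (1 : ℝ) else 0) β) :=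
  isPolyaFrequencySeq_delta.mulLinear hβ

/-- `1/(1 + βz) = Σ (-β)ⁿ zⁿ`: the reciprocal sequence of `(1, β, 0, …)`. [folklore] -/
theorem recipSeq_oneLinear (β : ℝ) (n : ℕ) :
    recipSeq (mulLinear (fun k => if k = 0 then (1 : ℝ) else 0) β) n = (-β) ^ n := by
  induction n using Nat.strong_induction_on with
  | _ n ih =>
    rcases n with _ | n
    · simpa using recipSeq_zero (oneLinear_zero β)
    · have h := sum_mul_recipSeq (a := mulLinear (fun k => if k = 0 then (1 : ℝ) else 0) β)
        (by rw [oneLinear_zero]; exact one_ne_zero) (n + 1)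
      rw [Finset.sum_range_succ', Finset.sum_range_succ'] at h
      have hz : ∑ k ∈ Finset.range n,
          mulLinear (fun k => if k = 0 then (1 : ℝ) else 0) β (k + 1 + 1) *
            recipSeq (mulLinear (fun k => if k = 0 then (1 : ℝ) else 0) β)
              (n + 1 - (k + 1 + 1)) = 0 :=
        Finset.sum_eq_zero fun k _ => by rw [oneLinear_add_two, zero_mul]
      rw [hz, zero_add, oneLinear_one, oneLinear_zero, one_mul, if_neg (Nat.succ_ne_zero n),
        show n + 1 - (0 + 1) = n by omega, Nat.sub_zero, ih n (Nat.lt_succ_self n)] at h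
      rw [pow_succ]
      linarith

/-- `negRecipSeq (1, β, 0, …) = (βⁿ)ₙ`: the Taylor sequence of `1/(1 - βz)`. [folklore] -/
theorem negRecipSeq_oneLinear (β : ℝ) (n : ℕ) :
    negRecipSeq (mulLinear (fun k => if k = 0 then (1 : ℝ) else 0) β) n = β ^ n := by
  rw [Literature.Analysis.TotalPositivity.negRecipSeq, recipSeq_oneLinear, ← mul_pow]
  congr 1
  ring

/-- **The geometric sequence `(βⁿ)ₙ` is PF for `β ≥ 0`** — "`1/(1 - βz)` generates a totally
positive sequence" — here obtained from the reciprocal rule applied to `1 + βz`.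
[AissenEdreiSchoenbergWhitney1951, p. 304; KungRotaYan2009, Prop. 6.9.4 (e)]
[cite: AissenEdreiSchoenbergWhitney1951, p. 304] -/
theorem isPolyaFrequencySeq_geometric {β : ℝ} (hβ : 0 ≤ β) : IsPolyaFrequencySeq fun n => β ^ n := by
  have h := (isPolyaFrequencySeq_oneLinear hβ).negRecipSeq (oneLinear_zero β)
  have heq : Literature.Analysis.TotalPositivity.negRecipSeq (mulLinear (fun k => if k = 0 then (1 : ℝ) else 0) β) =
      fun n => β ^ n :=
    funext (negRecipSeq_oneLinear β)
  rwa [heq] at h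

/-! ### The exponential sequence `(γⁿ/n!)`: Taylor coefficients of `e^{γz}` -/

/-- Coefficients of `(1 + tX)^N` are `(N choose n) tⁿ`. [folklore] -/
theorem coeff_one_add_C_mul_X_pow (t : ℝ) (N n : ℕ) :
    ((1 + Polynomial.C t * X) ^ N).coeff n = (N.choose n : ℝ) * t ^ n := by
  rw [add_comm, add_pow, Polynomial.finsetSum_coeff]
  have hterm : ∀ m ∈ Finset.range (N + 1),
      ((Polynomial.C t * X) ^ m * 1 ^ (N - m) * (N.choose m : ℝ[X])).coeff n =
        if n = m then (N.choose n : ℝ) * t ^ n else 0 := by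
    intro m _
    rw [one_pow, mul_one, mul_pow, ← Polynomial.C_pow, Polynomial.coeff_mul_natCast,
      Polynomial.coeff_C_mul_X_pow]
    split_ifs with h
    · subst h; ring
    · ring
  rw [Finset.sum_congr rfl hterm, Finset.sum_ite_eq]
  split_ifs with h
  · rfl
  · rw [Finset.mem_range, not_lt] at h
    rw [Nat.choose_eq_zero_of_lt (by omega), Nat.cast_zero, zero_mul]

/-- The coefficient sequence `((N choose n) (γ/N)ⁿ)ₙ` of `(1 + γz/N)^N` is PF for `γ ≥ 0`
(a finite product of the PF two-term sequences `(1, γ/N, 0, …)`).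
[KungRotaYan2009, Prop. 6.9.4 (b), (d)] [folklore] -/
theorem isPolyaFrequencySeq_choose_mul_pow {γ : ℝ} (hγ : 0 ≤ γ) (N : ℕ) :
    IsPolyaFrequencySeq fun n => (N.choose n : ℝ) * (γ / N) ^ n := by
  have h := isPolyaFrequencySeq_coeff_prod_linear (C := 1) zero_le_one (α := fun _ => γ / N)
    (fun _ => div_nonneg hγ (Nat.cast_nonneg N)) N
  simp only [map_one, one_mul, Finset.prod_const, Finset.card_range, coeff_one_add_C_mul_X_pow] at h
  exact h

/-- **The exponential sequence `(γⁿ/n!)ₙ` is PF for `γ ≥ 0`** — "`e^{γz}` generates a totally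
positive sequence": `(1 + γz/N)^N → e^{γz}` coefficientwise, `(N choose n)(γ/N)ⁿ → γⁿ/n!`
(Mathlib's `ProbabilityTheory.tendsto_choose_mul_pow_atTop`), and PF is closed under termwise
limits. [AissenEdreiSchoenbergWhitney1951, p. 304; KungRotaYan2009, Prop. 6.9.4 (d)]
[cite: AissenEdreiSchoenbergWhitney1951, p. 304] -/
theorem isPolyaFrequencySeq_exp {γ : ℝ} (hγ : 0 ≤ γ) : IsPolyaFrequencySeq fun n => γ ^ n / n ! := by
  refine IsPolyaFrequencySeq.of_tendsto (l := atTop) (isPolyaFrequencySeq_choose_mul_pow hγ)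
    fun n => ?_
  have hlim : Tendsto (fun N : ℕ => (N : ℝ) * (γ / N)) atTop (𝓝 γ) := by
    refine tendsto_const_nhds.congr' ?_
    filter_upwards [eventually_ne_atTop 0] with N hN
    have : (N : ℝ) ≠ 0 := by exact_mod_cast hN
    field_simp
  exact ProbabilityTheory.tendsto_choose_mul_pow_atTop (p := fun N : ℕ => γ / N) n hlim

end Literature.Analysis.TotalPositivity
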